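import Summits.HodgeConjecture.HodgeConjecture.Theorems.VHCAbelianSchemesRoadDegreeConfinementItems

/-!
# BC3 birth skeleton = LINE `birth`, v4 (stub 1 DISCHARGED; stub 2 CONFINED TO THE MIDDLE RANGE) — route `VHCAbelianSchemesRoad`
# (road b02), aside K-SR♭∃ `Theses.VHCAbelianSchemesRoad.SemiregularSheafRepresentativesLefAt` (stmt-HodgeConjecture-19779)

research route conditional on HC_CM; not a corollary; Q11.4-sentence-2 already refuted in dim ≥ 3.

REGIME SPLIT (structure vs. exceptional) as in v2/v3 (ring2 LEAD gen 145; v3 ab-andre-2 gen 53), now GRADED BY DEGREE (ab-andre-2 gen 54):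
* `stub_lefschetzRegime` — `W` algebraic-Lefschetz on EVERY fibre: the null carrier. PROVED (p434017, gate `landed`).
* `stub_exceptionalRegime_midRange` — `W` exceptional on some fibre, AT `(n, p)` with `2 ≤ p ≤ n − 2` ONLY: the research content (XL) —
  an `I`-semiregular locally free carrier with `ch_p = a·W| + (Lefschetz)` at some fibre. Off this range (in particular on every pencil of
  relative dimension `≤ 3`) the regime is VOID and PROVED (`lefAtExceptionalRegimeAt_of_offMidRange`, p442807, fact-free: Lefschetz `(1,1)`,
  hard Lefschetz, `H⁰ = ℂ·1` on the smooth projective fibres); v2/v3's ungraded `stub_exceptionalRegime` is EQUIVALENT to this stub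
  (`lefAtExceptionalRegime_iff_midRange`). FIRST PAIR `(n, p) = (4, 2)`.
* `stub_rung_sixfoldMiddle` — BC5 PLAN-ONLY first rung = the graded regime at `(6, 3)` (`Iff.rfl`), a literal instance of stub 2.
`SemiregularSheafRepresentativesLefAt_of` concludes the ROUTE decl BY NAME from stub 2 alone (stub 1 being a theorem, consumed inside
`semiregularSheafRepresentativesLefAt_route_iff_midRange`, p443066); sorries ONLY inside `stub_*` (2 = stub 2 + the plan-only rung). All regime
predicates are the LANDED constants of `Theorems/VHCAbelianSchemesRoadRegimeDefs.lean` (§1 p433748, §2 p441761).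
-/

noncomputable section

namespace Summit.HodgeConjecture.HodgeConjecture.Cruxes.SemiregularSheafRepresentativesLefAt.Birth

open Summit.HodgeConjecture.HodgeConjecture.Ring2.SemiregularRepresentatives
open Literature.AlgebraicGeometry.HodgeTheory
open Summit.Ventures.HSemireg (ObjClass bfSheafClass)

set_option linter.dupNamespace false
set_option linter.unusedVariables false

/-- STUB 1 (size S): the Lefschetz regime for the Buchweitz–Flenner sheaf door — the null carrier. PROVED (p434017). -/
theorem stub_lefschetzRegime : ∀ C : ChernCharacterBetti, LefAtLefschetzRegime (bfSheafClass C) :=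
  -- DISCHARGED (ab-andre-2 gen 53, p434017): the zero sheaf at the anchor fibre
  Summit.HodgeConjecture.HodgeConjecture.Theorems.SemiregularSheafRepresentativesLefAt.stub_lefschetzRegime

/-- STUB 2 (size XL, research), MIDDLE RANGE: the exceptional regime for the sheaf door AT `(n, p)`, `2 ≤ p ≤ n − 2` — an `I`-semiregular
locally free carrier with `ch_p = a·W| + (Lefschetz)` at some fibre of a pencil of abelian `n`-folds on which the codimension-`p` class `W`
is somewhere exceptional. (Off this range the statement is a THEOREM: `lefAtExceptionalRegimeAt_of_offMidRange`, p442807.) -/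
theorem stub_exceptionalRegime_midRange : ∀ (C : ChernCharacterBetti) (n p : ℕ), 2 ≤ p → p + 2 ≤ n →
    LefAtExceptionalRegimeAt (bfSheafClass C) n p := by
  sorry

/-- STUB 3 = BC5 PLAN-ONLY RUNG (size L–XL): the exceptional regime for sixfold pencils, `p = 3` — the graded regime at `(6, 3)`. -/
theorem stub_rung_sixfoldMiddle : ∀ C : ChernCharacterBetti, LefAtExceptionalRegimeSixfoldMiddle (bfSheafClass C) := by
  sorry

/-- The rung is a literal instance of stub 2 (`(6, 3)` is in the middle range; the rung predicate IS the graded regime at `(6, 3)`, `Iff.rfl`). -/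
theorem rung_of_exceptionalRegime_midRange
    (h : ∀ (C : ChernCharacterBetti) (n p : ℕ), 2 ≤ p → p + 2 ≤ n → LefAtExceptionalRegimeAt (bfSheafClass C) n p) :
    ∀ C : ChernCharacterBetti, LefAtExceptionalRegimeSixfoldMiddle (bfSheafClass C) :=
  fun C => h C 6 3 (by norm_num) (by norm_num)

/-- v2/v3's ungraded stub 2 is EQUIVALENT to the middle-range stub (degree confinement, p442807). -/
theorem exceptionalRegime_iff_midRange (C : ChernCharacterBetti) :
    LefAtExceptionalRegime (bfSheafClass C) ↔ ∀ (n p : ℕ), 2 ≤ p → p + 2 ≤ n → LefAtExceptionalRegimeAt (bfSheafClass C) n p :=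
  lefAtExceptionalRegime_iff_midRange

/-- **BC3 composition** — stub 2 (middle range) concludes the ROUTE crux decl BY NAME (type literally the route item). -/
theorem SemiregularSheafRepresentativesLefAt_of
    (h₂ : ∀ (C : ChernCharacterBetti) (n p : ℕ), 2 ≤ p → p + 2 ≤ n → LefAtExceptionalRegimeAt (bfSheafClass C) n p) :
    Summit.HodgeConjecture.HodgeConjecture.Theses.VHCAbelianSchemesRoad.SemiregularSheafRepresentativesLefAt :=
  semiregularSheafRepresentativesLefAt_route_iff_midRange.2 h₂

/-- The same composition concluding the carrier constant (the item's statement term). -/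
theorem ring2_semiregularSheafRepresentativesLefAt_of
    (h₂ : ∀ (C : ChernCharacterBetti) (n p : ℕ), 2 ≤ p → p + 2 ≤ n → LefAtExceptionalRegimeAt (bfSheafClass C) n p) :
    Summit.HodgeConjecture.HodgeConjecture.Ring2.SemiregularRepresentatives.SemiregularSheafRepresentativesLefAt :=
  semiregularSheafRepresentativesLefAt_iff_midRange.2 h₂

/-- Conversely the route item gives stub 2 back (no slack in the reshaping). -/
theorem midRange_of_route_item (h : Summit.HodgeConjecture.HodgeConjecture.Theses.VHCAbelianSchemesRoad.SemiregularSheafRepresentativesLefAt) :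
    ∀ (C : ChernCharacterBetti) (n p : ℕ), 2 ≤ p → p + 2 ≤ n → LefAtExceptionalRegimeAt (bfSheafClass C) n p :=
  semiregularSheafRepresentativesLefAt_route_iff_midRange.1 h

/-- The route crux from the registered stubs (sanity: NOT a proof of the item — sorryAx via stub 2, as designed). -/
theorem semiregularSheafRepresentativesLefAt_of_stubs :
    Summit.HodgeConjecture.HodgeConjecture.Theses.VHCAbelianSchemesRoad.SemiregularSheafRepresentativesLefAt :=
  SemiregularSheafRepresentativesLefAt_of stub_exceptionalRegime_midRange

end Summit.HodgeConjecture.HodgeConjecture.Cruxes.SemiregularSheafRepresentativesLefAt.Birth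

end
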